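import Literature.AlgebraicGeometry.HodgeTheory.ComplexOrientationDegreeFibre
import Literature.AlgebraicTopology.SingularHomology.LocalHomology
import HarnessLib

/-!
# An isomorphism of smooth projective complex varieties has degree `1` for the complex orientations: `τ(ℂ)_* [X(ℂ)] = [Y(ℂ)]`

Family `hodge`, layer `Literature/AlgebraicGeometry/HodgeTheory`; theorems and one plumbing def (no named fact). Written by the prover
seat `hodge-nonav-prover-Ax` (g18). W. Fulton, *Intersection Theory* (1998), Lemma 19.1.2 with `deg = 1`; topologically: a holomorphic
homeomorphism preserves the complex orientation (Milnor–Stasheff §13). The tree proves the finite-fibre degree formula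
`q(ℂ)_* [T(ℂ)] = (#ι) • [W(ℂ)]` (`hasDegree_complexOrientationRat_of_finite_fibre`, file `ComplexOrientationDegreeFibre`); this file is
its one-point-fibre case for an ISOMORPHISM `τ : X ≅ Y` (in particular an automorphism — the deck transformations `τ`, `j` of a member
of the quaternionic quartic family), which is the input `τ(ℂ)_* [X] = [X]` of the duality squares
`Summit…Theorems.Q8BireflectionRecognitionHomological.map_poincareDualityMap_map` ∕
`exists_bireflection_datum_of_homological_datum_poincare` (crux K1Q, stub S5, `Summits/HodgeConjecture/HodgeConjecture/Theses/Q8SymplecticPowers.lean`).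

* `AlgPoints.homeomorphOfIso` — `τ(ℂ) : X(ℂ) ≃ₜ Y(ℂ)` for an isomorphism `τ`.
* **`hasDegree_one_complexOrientationRat_of_iso`**, **`map_fundamentalClass_complexOrientationRat_of_iso`** (`ℚ`),
  **`map_fundamentalClass_complexOrientationFamily_of_iso`** (`ℂ`).

## References

* [Fulton1998] W. Fulton, Intersection Theory, 2nd ed., Springer 1998, Lemma 19.1.2.
* [MilnorStasheff1974] J. Milnor, J. Stasheff, Characteristic Classes, §13 (complex manifolds are oriented).
-/

noncomputable section

open CategoryTheory
open Literature.AlgebraicTopology.SingularHomology Literature.AlgebraicGeometry.Motives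

namespace Literature.AlgebraicGeometry.HodgeTheory

variable {d : ℕ} {X Y : Motives.SchemeOver ℂ}

/-- **`τ(ℂ) : X(ℂ) ≃ₜ Y(ℂ)`** for an isomorphism `τ : X ≅ Y` of `ℂ`-schemes (functoriality of `AlgPoints.map`). [cite: Fulton1998, Lemma 19.1.2] -/
def AlgPoints.homeomorphOfIso (τ : X ≅ Y) : Motives.ComplexPoints X ≃ₜ Motives.ComplexPoints Y where
  toFun := AlgPoints.map τ.hom
  invFun := AlgPoints.map τ.inv
  left_inv P := by rw [← AlgPoints.map_comp_apply, τ.hom_inv_id, AlgPoints.map_id_apply]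
  right_inv P := by rw [← AlgPoints.map_comp_apply, τ.inv_hom_id, AlgPoints.map_id_apply]
  continuous_toFun := (AlgPoints.mapContinuous (L := ℂ) τ.hom).continuous
  continuous_invFun := (AlgPoints.mapContinuous (L := ℂ) τ.inv).continuous

/-- `homeomorphOfIso τ = τ(ℂ)` as functions. [cite: Fulton1998, Lemma 19.1.2] -/
@[simp] theorem AlgPoints.coe_homeomorphOfIso (τ : X ≅ Y) :
    (AlgPoints.homeomorphOfIso τ : Motives.ComplexPoints X → Motives.ComplexPoints Y) = AlgPoints.map τ.hom := rfl

/-- **An isomorphism of smooth projective `d`-folds has degree `1` for the rational complex orientations**: `τ(ℂ)_* [X(ℂ)] = 1 • [Y(ℂ)]`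
(the finite-fibre degree formula with the one-point fibre `{τ⁻¹(b)}`, `τ(ℂ)` a homeomorphism). [cite: Fulton1998, Lemma 19.1.2] -/
theorem hasDegree_one_complexOrientationRat_of_iso (hX : Motives.IsSmoothProjective d X) (hY : Motives.IsSmoothProjective d Y) (τ : X ≅ Y)
    (b : Motives.ComplexPoints Y) :
    HasDegree (complexOrientationRat hX) (complexOrientationRat hY) (AlgPoints.mapContinuous (L := ℂ) τ.hom) (Fintype.card Unit) := by
  refine hasDegree_complexOrientationRat_of_finite_fibre hX hY τ.hom (ι := Unit) (v := fun _ => AlgPoints.map τ.inv b)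
    (fun _ _ _ => Subsingleton.elim _ _) (b := b) ?_ fun _ => ⟨(AlgPoints.homeomorphOfIso τ).toOpenPartialHomeomorph, ?_, rfl⟩
  · ext P
    simp only [Set.mem_preimage, Set.mem_singleton_iff, Set.mem_range, exists_const]
    constructor
    · intro h; rw [← h, ← AlgPoints.map_comp_apply, τ.hom_inv_id, AlgPoints.map_id_apply]
    · intro h; rw [← h, ← AlgPoints.map_comp_apply, τ.inv_hom_id, AlgPoints.map_id_apply]
  · simp

/-- **`τ(ℂ)_* [X(ℂ)] = [Y(ℂ)]`** in `H_{2d}(Y(ℂ); ℚ)` for an isomorphism `τ : X ≅ Y` of smooth projective `d`-folds (rational complex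
orientations); for `Y = X`: the deck transformations fix the fundamental class. [cite: Fulton1998, Lemma 19.1.2] -/
theorem map_fundamentalClass_complexOrientationRat_of_iso (hX : Motives.IsSmoothProjective d X) (hY : Motives.IsSmoothProjective d Y)
    (τ : X ≅ Y) :
    singularHomology.map ℚ ℚ (AlgPoints.mapContinuous (L := ℂ) τ.hom) (2 * d) (complexOrientationRat hX).fundamentalClass =
      (complexOrientationRat hY).fundamentalClass := by
  rcases isEmpty_or_nonempty (Motives.ComplexPoints Y) with hE | ⟨⟨b⟩⟩
  · -- no complex points: `H_{2d}(Y(ℂ)) = 0`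
    haveI : IsEmpty (Motives.ComplexPoints Y) := hE
    haveI : Subsingleton (singularHomology ℚ ℚ (Motives.ComplexPoints Y) (2 * d)) :=
      ModuleCat.subsingleton_of_isZero ((isZero_csingularHomology_of_isEmpty (R := ℚ) (M := ℚ) (X := Motives.ComplexPoints Y)
        (2 * d)).of_iso (csingularHomology.compIso ℚ ℚ (Motives.ComplexPoints Y) (2 * d)).symm)
    exact Subsingleton.elim _ _
  · have h := hasDegree_one_complexOrientationRat_of_iso hX hY τ b
    rw [HasDegree, Fintype.card_unit, Nat.cast_one, one_smul] at h
    exact h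

/-- The same for the complex orientation FAMILY (`ℂ`-coefficients). [cite: Fulton1998, Lemma 19.1.2] -/
theorem map_fundamentalClass_complexOrientationFamily_of_iso (hX : Motives.IsSmoothProjective d X) (hY : Motives.IsSmoothProjective d Y)
    (τ : X ≅ Y) :
    singularHomology.map ℂ ℂ (AlgPoints.mapContinuous (L := ℂ) τ.hom) (2 * d) (complexOrientationFamily hX).fundamentalClass =
      (complexOrientationFamily hY).fundamentalClass := by
  rw [fundamentalClass_complexOrientationFamily, fundamentalClass_complexOrientationFamily, ← singularHomology.coeffChange_map,
    map_fundamentalClass_complexOrientationRat_of_iso hX hY τ]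

end Literature.AlgebraicGeometry.HodgeTheory

end
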